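import Mathlib
import Summits.Ventures.PercRepro2.Tail2DBlockCalc
import Summits.Ventures.PercRepro2.Tail2DHarrisSP
import Summits.Ventures.PercRepro2.Tail2DFlowOneBlocks
import Summits.Ventures.PercRepro2.Tail2DFlowOneStep01
import Summits.Ventures.PercRepro2.Tail2DParFin
import Summits.Ventures.PercRepro2.Tail2DParFinFlip
import Summits.Ventures.PercRepro2.Tail2DParFinTop
import Summits.Ventures.PercRepro2.Tail2DParFinDiag
import Summits.Ventures.PercRepro2.Tail2DSDomSwap
import Summits.Ventures.PercRepro2.Tail2DParFinCount
import Summits.Ventures.PercRepro2.Tail2DParFinRelax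
import Summits.Ventures.PercRepro2.Tail2DParFinSubTop
import Summits.Ventures.PercRepro2.Tail2DParFinSubTopB
import Summits.Ventures.PercRepro2.Tail2DParFinSubTopC

/-!
# (SD) at the sub-top level `u + v = k − 1` on `k` flow-one factors: the theorem
(seat mine-b, cell pub-perc-repro2; conjectures/MINE-B.md §44)

The rate received by every word of the target tail is `λ` (`tRate_eq`): a common word receives `ι` and `(v+1)/(u+1)`
from the bottom words above it; a class-1 top word (one `C`) receives `(v+1)/u` from the bottom words of its class and
`ξ` from the relax of its `C`; a class-0 top word receives `Σ_{j blue} (f(w[j→R], j) + ξ) = (v+2)((1−ι)/u − ξΓ/k) = λ`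
— the identity that fixes `λ = |E|/|E'|`.  Hence the target coverage (`st_tgt_cov`) and **`sdomZ_parFin_subtop`**:
(SD) at every position `(u, v)` with `u + v + 1 = k`, `u ≥ v + 2`, on `X₀ ∥ … ∥ X_{k−1}` for any `k` flow-one factors
with red crossings; with the diagonal (`sdomZ_parFin_diag`) and the colour swap (`sdomZ_swap_iff`) the whole sub-top
level `sdomZ_parFin_subtop_all`, and the ℕ-form `sdom_parFin_subtop`.
-/

namespace Summit.Ventures.PercRepro2.Tail2D

open V2Closure Finset

section TargetRate

variable (k : ℕ) (X : Fin k → V2Closure.SP) (u v : ℕ)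

/-- the rate received by a word: identity, flips from its blue positions, relaxes from its blue and `C` positions -/
noncomputable def tRate (w0 : Fin k → Ltr) : ℚ :=
  ∑ i, ((if stCom k u v w0 then iotaQ k X u v / k else 0)
    + (if w0 i = Ltr.B ∧ stSrc k u v (Function.update w0 i Ltr.R)
        then rateFl k X u v (Function.update w0 i Ltr.R) i else 0)
    + (if (w0 i = Ltr.B ∨ w0 i = Ltr.C) ∧ stCom k u v (Function.update w0 i Ltr.R) then xiQ k X u v else 0))

variable {k X u v}

/-- a word receiving a flip or a relax, or keeping its identity, is in the target tail -/
theorem tgt_of_term (hk : u + v + 1 = k) (w0 : Fin k → Ltr) (i : Fin k)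
    (h : stCom k u v w0 ∨ (w0 i = Ltr.B ∧ stSrc k u v (Function.update w0 i Ltr.R))
      ∨ ((w0 i = Ltr.B ∨ w0 i = Ltr.C) ∧ stCom k u v (Function.update w0 i Ltr.R))) :
    u - 1 ≤ nR k w0 ∧ v + 1 ≤ nB k w0 := by
  rcases h with h | ⟨hB, hs⟩ | ⟨hBC, hc⟩
  · have := stCom_nR hk w0 h; have := h.2; omega
  · have e1 := nR_update_R k w0 i (by rw [hB]; exact Ltr.noConfusion)
    have e2 := nB_update_R_of_B k w0 i hB
    have := hs.1; have := hs.2; omega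
  · have e1 := nR_update_R k w0 i (by rcases hBC with h | h <;> rw [h] <;> exact Ltr.noConfusion)
    have hn := stCom_nR hk _ hc
    have hb := hc.2
    rcases hBC with h | h
    · have e2 := nB_update_R_of_B k w0 i h; omega
    · have e2 := nB_update_R_of_ne k w0 i (by rw [h]; exact Ltr.noConfusion); omega

/-- **the rate received by every word**: `λ` on the target tail, `0` elsewhere -/
theorem tRate_eq (hX : ∀ i, FlowOne (X i)) (hR : ∀ i, 0 < (rSet (X i)).card) (hk : u + v + 1 = k)
    (huv : v + 2 ≤ u) (w0 : Fin k → Ltr) :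
    tRate k X u v w0 = if (u - 1 ≤ nR k w0 ∧ v + 1 ≤ nB k w0) then lamQ k X u v else 0 := by
  have h3 := nR_add_nB_add_nC k w0
  have hkpos : (0 : ℚ) < k := by exact_mod_cast (show 0 < k by omega)
  have hupos : (0 : ℚ) < u := by exact_mod_cast (show 0 < u by omega)
  unfold tRate
  by_cases ht : u - 1 ≤ nR k w0 ∧ v + 1 ≤ nB k w0
  · rw [if_pos ht]
    -- the three types of target words
    have hcases : (nR k w0 = u ∧ nB k w0 = v + 1 ∧ nC k w0 = 0)
        ∨ (nR k w0 = u - 1 ∧ nB k w0 = v + 2 ∧ nC k w0 = 0)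
        ∨ (nR k w0 = u - 1 ∧ nB k w0 = v + 1 ∧ nC k w0 = 1) := by omega
    -- the blue and `C` positions
    have hsumB : ∀ c : ℚ, ∑ i, (if w0 i = Ltr.B then c else 0) = (nB k w0 : ℚ) * c := by
      intro c
      rw [← Finset.sum_filter]
      have : (Finset.univ.filter (fun i => w0 i = Ltr.B)) = blueSet k w0 := rfl
      rw [this, Finset.sum_const, ← nB_eq_card_blueSet, nsmul_eq_mul]
    have hsumC : ∀ c : ℚ, ∑ i, (if w0 i = Ltr.C then c else 0) = (nC k w0 : ℚ) * c := by
      intro c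
      rw [← Finset.sum_filter]
      have : (Finset.univ.filter (fun i => w0 i = Ltr.C)) = cSet k w0 := rfl
      rw [this, Finset.sum_const, nsmul_eq_mul]
      rfl
    simp only [Finset.sum_add_distrib]
    rcases hcases with ⟨hr, hb, hc⟩ | ⟨hr, hb, hc⟩ | ⟨hr, hb, hc⟩
    · -- (a) a common word: `ι + (v+1)/(u+1)`
      have hcom : stCom k u v w0 := ⟨⟨by omega, by omega⟩, hb⟩
      have hnoC : ∀ i, w0 i ≠ Ltr.C := stCom_noC hk w0 hcom
      rw [Finset.sum_const, Finset.card_univ, Fintype.card_fin, nsmul_eq_mul, if_pos hcom]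
      have e2 : ∀ i, (if w0 i = Ltr.B ∧ stSrc k u v (Function.update w0 i Ltr.R)
          then rateFl k X u v (Function.update w0 i Ltr.R) i else 0)
          = if w0 i = Ltr.B then ((u : ℚ) + 1)⁻¹ else 0 := by
        intro i
        by_cases hi : w0 i = Ltr.B
        · have e1 := nR_update_R k w0 i (by rw [hi]; exact Ltr.noConfusion)
          have e2 := nB_update_R_of_B k w0 i hi
          have hs : stSrc k u v (Function.update w0 i Ltr.R) := ⟨by omega, by omega⟩
          rw [if_pos ⟨hi, hs⟩, if_pos hi]
          unfold rateFl
          rw [if_pos ⟨hs, by omega⟩, e1, hr]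
          push_cast; rfl
        · rw [if_neg (fun h => hi h.1), if_neg hi]
      have e3 : ∀ i, (if (w0 i = Ltr.B ∨ w0 i = Ltr.C) ∧ stCom k u v (Function.update w0 i Ltr.R)
          then xiQ k X u v else 0) = 0 := by
        intro i
        rw [if_neg]
        rintro ⟨hBC, hc'⟩
        rcases hBC with hi | hi
        · have e2 := nB_update_R_of_B k w0 i hi
          have := hc'.2; omega
        · exact hnoC i hi
      simp only [e2, e3, hsumB, Finset.sum_const_zero, add_zero, hb]
      unfold iotaQ
      push_cast
      field_simp
      ring
    · -- (b) a class-0 top word: the flips and relaxes of its blue positions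
      have hncom : ¬ stCom k u v w0 := fun h => by have := h.2; omega
      have hnoC : ∀ i, w0 i ≠ Ltr.C := by
        intro i hi
        have : 0 < nC k w0 := Finset.card_pos.2 ⟨i, by simp [cSet, hi]⟩
        omega
      rw [Finset.sum_const, Finset.card_univ, Fintype.card_fin, nsmul_eq_mul, if_neg hncom, mul_zero, zero_add]
      have e2 : ∀ i, (if w0 i = Ltr.B ∧ stSrc k u v (Function.update w0 i Ltr.R)
          then rateFl k X u v (Function.update w0 i Ltr.R) i else 0)
          = if w0 i = Ltr.B then flQ k X u v (Function.update w0 i Ltr.R) i else 0 := by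
        intro i
        by_cases hi : w0 i = Ltr.B
        · have e1 := nR_update_R k w0 i (by rw [hi]; exact Ltr.noConfusion)
          have e2 := nB_update_R_of_B k w0 i hi
          have hs : stSrc k u v (Function.update w0 i Ltr.R) := ⟨by omega, by omega⟩
          rw [if_pos ⟨hi, hs⟩, if_pos hi]
          unfold rateFl
          rw [if_neg (fun h => by have := h.2; omega)]
        · rw [if_neg (fun h => hi h.1), if_neg hi]
      have e3 : ∀ i, (if (w0 i = Ltr.B ∨ w0 i = Ltr.C) ∧ stCom k u v (Function.update w0 i Ltr.R)
          then xiQ k X u v else 0) = if w0 i = Ltr.B then xiQ k X u v else 0 := by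
        intro i
        by_cases hi : w0 i = Ltr.B
        · have e1 := nR_update_R k w0 i (by rw [hi]; exact Ltr.noConfusion)
          have e2 := nB_update_R_of_B k w0 i hi
          rw [if_pos ⟨Or.inl hi, ⟨by omega, by omega⟩, by omega⟩, if_pos hi]
        · rw [if_neg (fun h => h.1.elim hi (hnoC i)), if_neg hi]
      simp only [e2, e3, hsumB, hb]
      -- the flip rates of the unflips
      have e4 : ∀ i, (if w0 i = Ltr.B then flQ k X u v (Function.update w0 i Ltr.R) i else 0)
          = if w0 i = Ltr.B then ((1 - iotaQ k X u v) / u - xiQ k X u v - xiQ k X u v / k * gamRed k X w0)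
            - xiQ k X u v / k * (v + 2) * gam k X i else 0 := by
        intro i
        by_cases hi : w0 i = Ltr.B
        · rw [if_pos hi, if_pos hi]
          unfold flQ
          rw [gamRed_update_R k X w0 i (by rw [hi]; exact Ltr.noConfusion)]
          ring
        · rw [if_neg hi, if_neg hi]
      simp only [e4]
      rw [← Finset.sum_filter]
      have hbl : (Finset.univ.filter (fun i => w0 i = Ltr.B)) = blueSet k w0 := rfl
      rw [hbl, Finset.sum_sub_distrib, Finset.sum_const, ← Finset.mul_sum, ← nB_eq_card_blueSet, hb, nsmul_eq_mul]
      have hG := gamRed_add_blue k X w0 hnoC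
      have hx : (∑ i, gam k X i) = gx k X * k := by unfold gx; field_simp
      rw [hx] at hG
      have key := sub_top_identity u v (gx k X) (gx_nonneg k X) (by omega)
      rw [← lamQ_eq k X u v hX hR hk (by omega)] at key
      rw [← key]
      unfold iotaQ xiQ
      have hsum : (∑ i ∈ blueSet k w0, gam k X i) = gx k X * k - gamRed k X w0 := by linarith
      rw [hsum]
      push_cast
      field_simp
      ring
    · -- (c) a class-1 top word: `(v+1)/u` from the flips of its class, `ξ` from the relax of its `C`
      have hncom : ¬ stCom k u v w0 := fun h => by have := h.1.1; omega
      rw [Finset.sum_const, Finset.card_univ, Fintype.card_fin, nsmul_eq_mul, if_neg hncom, mul_zero, zero_add]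
      have e2 : ∀ i, (if w0 i = Ltr.B ∧ stSrc k u v (Function.update w0 i Ltr.R)
          then rateFl k X u v (Function.update w0 i Ltr.R) i else 0)
          = if w0 i = Ltr.B then ((u : ℚ))⁻¹ else 0 := by
        intro i
        by_cases hi : w0 i = Ltr.B
        · have e1 := nR_update_R k w0 i (by rw [hi]; exact Ltr.noConfusion)
          have e2 := nB_update_R_of_B k w0 i hi
          have hs : stSrc k u v (Function.update w0 i Ltr.R) := ⟨by omega, by omega⟩
          rw [if_pos ⟨hi, hs⟩, if_pos hi]
          unfold rateFl
          rw [if_pos ⟨hs, by omega⟩, e1, hr]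
          push_cast
          have : ((u - 1 : ℕ) : ℚ) + 1 = u := by
            have : 1 ≤ u := by omega
            push_cast [Nat.cast_sub this]; ring
          rw [this]
        · rw [if_neg (fun h => hi h.1), if_neg hi]
      have e3 : ∀ i, (if (w0 i = Ltr.B ∨ w0 i = Ltr.C) ∧ stCom k u v (Function.update w0 i Ltr.R)
          then xiQ k X u v else 0) = if w0 i = Ltr.C then xiQ k X u v else 0 := by
        intro i
        by_cases hi : w0 i = Ltr.C
        · have e1 := nR_update_R k w0 i (by rw [hi]; exact Ltr.noConfusion)
          have e2 := nB_update_R_of_ne k w0 i (by rw [hi]; exact Ltr.noConfusion)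
          rw [if_pos ⟨Or.inr hi, ⟨by omega, by omega⟩, by omega⟩, if_pos hi]
        · rw [if_neg, if_neg hi]
          rintro ⟨hBC, hc'⟩
          rcases hBC with h | h
          · have e2 := nB_update_R_of_B k w0 i h
            have := hc'.2; omega
          · exact hi h
      simp only [e2, e3, hsumB, hsumC, hb, hc]
      unfold xiQ
      push_cast
      field_simp
      ring
  · rw [if_neg ht]
    apply Finset.sum_eq_zero
    intro i _
    rw [if_neg (fun h => ht (tgt_of_term hk w0 i (Or.inl h))),
      if_neg (fun h => ht (tgt_of_term hk w0 i (Or.inr (Or.inl h)))),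
      if_neg (fun h => ht (tgt_of_term hk w0 i (Or.inr (Or.inr h))))]
    ring

end TargetRate

section Theorem

variable (k : ℕ) (X : Fin k → V2Closure.SP) (u v : ℕ)

/-- **the target coverage of the sub-top certificate** -/
theorem st_tgt_cov (hX : ∀ i, FlowOne (X i)) (hR : ∀ i, 0 < (rSet (X i)).card) (hk : u + v + 1 = k)
    (huv : v + 2 ≤ u) (z : (parFin k X).Conf) :
    ∑ p : (Fin k → Ltr) × Fin k × Fin 3,
      stW k X u v p.1 p.2.1 p.2.2 * unifDens (parFin k X) (stQ k X u v p.1 p.2.1 p.2.2) z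
      = unifDens (parFin k X) (tailSet (parFin k X) (u - 1) (v + 1)) z := by
  set w0 := wordOf k X z with hw0
  set E : ℚ := (tailCount (parFin k X) u v : ℚ) with hE
  set E' : ℚ := (tailCount (parFin k X) (u - 1) (v + 1) : ℚ) with hE'
  have hEpos : 0 < E := tailCount_subtop_pos k X u v hX hR hk
  have hE'pos : 0 < E' := tailCount_subtop_pos k X (u - 1) (v + 1) hX hR (by omega)
  have hRHS : unifDens (parFin k X) (tailSet (parFin k X) (u - 1) (v + 1)) z
      = if (u - 1 ≤ nR k w0 ∧ v + 1 ≤ nB k w0) then E'⁻¹ else 0 := by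
    unfold unifDens
    rw [hE', tailCount_eq_card]
    by_cases h : z ∈ tailSet (parFin k X) (u - 1) (v + 1)
    · rw [if_pos h, if_pos ((mem_tailSet_parFin k X hX (u - 1) (v + 1) z).1 h)]
    · rw [if_neg h, if_neg (fun hh => h ((mem_tailSet_parFin k X hX (u - 1) (v + 1) z).2 hh))]
  rw [hRHS, Fintype.sum_prod_type]
  simp only [st_tgt_term k X u v hX]
  rw [Finset.sum_comm, Fintype.sum_prod_type]
  simp only [Fin.sum_univ_three, sum_tTerm_zero, sum_tTerm_one, sum_tTerm_two]
  -- pull out the common denominator `|E|`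
  have hdiv : ∀ (c : Prop) [Decidable c] (a : ℚ), (if c then a / E else 0) = (if c then a else 0) / E := by
    intro c _ a; split_ifs <;> simp
  simp only [← hw0, ← hE]
  simp only [hdiv, ← add_div, ← Finset.sum_div]
  have := tRate_eq hX hR hk huv w0
  unfold tRate at this
  rw [this]
  by_cases ht : u - 1 ≤ nR k w0 ∧ v + 1 ≤ nB k w0
  · rw [if_pos ht, if_pos ht]
    unfold lamQ
    rw [← hE, ← hE']
    field_simp
  · rw [if_neg ht, if_neg ht, zero_div]

/-- **(SD) at every sub-top position `(u, v)`, `u + v = k − 1`, `u ≥ v + 2`, on the parallel composition of `k`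
flow-one factors with red crossings, for every `k`**: the uniform measure on `{r ≥ u, b ≥ v}` is stochastically
dominated by the uniform measure on `{r ≥ u − 1, b ≥ v + 1}` -/
theorem sdomZ_parFin_subtop (hX : ∀ i, FlowOne (X i)) (hR : ∀ i, 0 < (rSet (X i)).card) (hk : u + v + 1 = k)
    (huv : v + 2 ≤ u) : SDomZ (parFin k X) (u : ℤ) (v : ℤ) := by
  rw [sdomZ_iff_blockDom]
  have e1 : ((u : ℤ)).toNat = u := by omega
  have e2 : ((v : ℤ)).toNat = v := by omega
  have e3 : ((u : ℤ) - 1).toNat = u - 1 := by omega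
  have e4 : ((v : ℤ) + 1).toNat = v + 1 := by omega
  rw [e1, e2, e3, e4]
  exact blockDom_of_mixture (parFin k X) (fun p : (Fin k → Ltr) × Fin k × Fin 3 => stP k X u v p.1 p.2.1 p.2.2)
    (fun p => stQ k X u v p.1 p.2.1 p.2.2) (fun p => stW k X u v p.1 p.2.1 p.2.2)
    (fun p => stW_nonneg hX hR hk huv p.1 p.2.1 p.2.2) (fun p => stP_dom hX p.1 p.2.1 p.2.2)
    (fun p => stQ_nonempty hX hR hk p.1 p.2.1 p.2.2) _ _ (st_src_cov k X u v hX hR hk huv)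
    (st_tgt_cov k X u v hX hR hk huv)

/-- **(SD) at every position of the sub-top level**, both sides of the diagonal: for `u + v + 1 = k` and
`1 ≤ u`, `SDomZ (parFin k X) u v` — red-heavy positions directly, the diagonal by `sdomZ_parFin_diag`,
blue-heavy positions by the colour swap -/
theorem sdomZ_parFin_subtop_all (hX : ∀ i, FlowOne (X i)) (hR : ∀ i, 0 < (rSet (X i)).card) (hk : u + v + 1 = k)
    (hu : 1 ≤ u) : SDomZ (parFin k X) (u : ℤ) (v : ℤ) := by
  rcases lt_trichotomy u (v + 1) with h | h | h
  · -- blue-heavy: swap to `(v + 1, u − 1)`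
    rw [sdomZ_swap_iff]
    have e : ((u : ℤ) - 1) = ((u - 1 : ℕ) : ℤ) := by omega
    rw [e, show ((v : ℤ) + 1) = ((v + 1 : ℕ) : ℤ) by push_cast; ring]
    exact sdomZ_parFin_subtop k X (v + 1) (u - 1) hX hR (by omega) (by omega)
  · subst h
    have e : ((v : ℤ)) = ((v + 1 : ℕ) : ℤ) - 1 := by push_cast; ring
    rw [e]
    exact sdomZ_parFin_diag k X (v + 1) hX (by omega)
  · exact sdomZ_parFin_subtop k X u v hX hR hk (by omega)

/-- the ℕ-form: for every monotone weight `f`, `Σ_f(u,v) · T(u−1,v+1) ≤ Σ_f(u−1,v+1) · T(u,v)` at the sub-top level -/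
theorem sdom_parFin_subtop (hX : ∀ i, FlowOne (X i)) (hR : ∀ i, 0 < (rSet (X i)).card) (hk : u + v + 1 = k)
    (hu : 1 ≤ u) (f : (parFin k X).Conf → ℕ) (hf : Monotone f) :
    tailSum (parFin k X) f u v * tailCount (parFin k X) (u - 1) (v + 1)
      ≤ tailSum (parFin k X) f (u - 1) (v + 1) * tailCount (parFin k X) u v := by
  have key := sdomZ_parFin_subtop_all k X u v hX hR hk hu f hf
  have e1 : ((u : ℤ)).toNat = u := by omega
  have e2 : ((v : ℤ)).toNat = v := by omega
  have e3 : ((u : ℤ) - 1).toNat = u - 1 := by omega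
  have e4 : ((v : ℤ) + 1).toNat = v + 1 := by omega
  rw [e1, e2, e3, e4] at key
  exact key

end Theorem


end Summit.Ventures.PercRepro2.Tail2D
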